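import Summits.CriticalPhenomena.PercolationContinuityZ3.Theses.PercRayRenewal
import Summits.CriticalPhenomena.PercolationContinuityZ3.Theorems.NearLinearTwoClusterDecay.Negative.Structure
import Summits.CriticalPhenomena.PercolationContinuityZ3.Theorems.NearLinearTwoClusterDecay.Negative.Rays
import Summits.CriticalPhenomena.PercolationContinuityZ3.Theorems.PercRayRenewalTwoArmsRatioExponentFiniteSizeCriterion

/-!
# Crux `PercRayRenewal.TwoArmsRatioExponent` (stmt-CriticalPhenomena-4625) — structure and DOMINANCE

Kernel-checked bookkeeping by the line lead (prover-line-stmt-CriticalPhenomena-4625-c2-0,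
line `registered`), for the planners / strategist:

* `twoArmsRatioExponent_iff` — the crux's inline event IS the sibling vocabulary
  `twoClusterEvt r n` of `Theorems/NearLinearTwoClusterDecay/Negative/` (two clusters of the
  configuration restricted to `Λ(n)`, distinct inside `Λ(n)`, both meeting `Λ(r)` and `∂ⁱⁿΛ(n)`),
  so `T2 ↔ ∃ c > 1, C, ∀ 1 ≤ r ≤ n, P_{p_c}(twoClusterEvt r n) ≤ C (r/n)^c`.
* `unitBox_law_of_twoArmsRatioExponent` — `T2 ⇒` the POINTWISE two-arms law from the unit box,
  `f(n) = P(twoClusterEvt 1 n) ≤ C n^{-c}` with `c > 1` (instance `r = 1`): already an open problem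
  (rigorous exponent `≥ 12/23` only, Cerf 2015 Thm 1.1, site; `≤ 19`, vdB–vE 2022 Thm 1).
* `atExponent_of_twoArmsRatioExponent` — `T2 ⇒ AtExponent α` for EVERY `α > 1`
  (decay of `P(twoClusterEvt n ⌈n^α⌉)`, rate `C n^{-(α-1)c}`).
* **DOMINANCE.** `critBoxTwoArmsDecay_of_twoArmsRatioExponent` : `T2 ⇒ PercFiniteBoxLRO.CritBoxTwoArmsDecay`
  (crux stmt-CriticalPhenomena-0859, `∀ α > 1`) and
  `nearLinearTwoClusterDecay_of_twoArmsRatioExponent` : `T2 ⇒ PercShatteringRace.NearLinearTwoClusterDecay`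
  (crux stmt-CriticalPhenomena-5785, `α = 7/6`).  Both sibling cruxes are OPEN after long line
  campaigns; `T2` is strictly stronger (a quantitative exponent `> 1`, uniform ratio form) — any
  line for `T2` must in particular close stmt-0859 and stmt-5785, so `T2` should be parked behind them.

* **FS with ANY power saving gives the sibling cruxes** (cycle-2 reshape, lead c2):
  `atExponent_of_fs_eps` — if for some aspect ratio `M ≥ 2`, scale `s₀` and `ε > 0` the thinned
  two-distinct-crossings probability satisfies `P(outer(s, M s)) ≤ M^{-ε}` for all `s ≥ s₀`
  (`outer(s,n) = (· ∩ E(Λ s)ᶜ) ⁻¹' twoClusterEvt s n`), then `AtExponent α` for every `α > 1`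
  (via the landed `real_twoClusterEvt_le_of_fs`: sub-multiplicativity over disjoint annuli), hence
  `critBoxTwoArmsDecay_of_fs_eps` (stmt-0859) and `nearLinearTwoClusterDecay_of_fs_eps` (stmt-5785);
  with `ε > 1` the same criterion gives T2 itself (`ratioLaw_of_finiteSizeCriterion`, the v3 skeleton).
* `fs_of_outerRatioLaw` — the thinned ratio law `T2'` (the crux with `A₂` replaced by the larger event
  `outer ⊇ A₂`) implies FS; so `T2' ⇒ FS ⇒ T2`: the reshape loses at most the thinning.
* `atExponent_of_outer_le_one_sub` (+ corollaries for stmt-0859 / stmt-5785): ANY uniform bound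
  `P(outer(s, Ms)) ≤ 1 - η < 1` at ONE aspect ratio already gives both sibling cruxes —
  sub-multiplicativity converts uniform non-certainty into a polynomial rate.
* **The route over-demands**: `percolationContinuityZ3_of_jumpWorldT2` /
  `percolationContinuityZ3_of_jumpWorldFS` — with `G` and the proved `Assembly`, the sub-problem
  needs T2 (or FS) only under the hypothesis `0 < θ(p_c)` (the jump world); the planners may restate
  the crux in that (vacuous-if-true-summit, `d > 6`-immune) form.

No new definitions; sorry-free.
-/

namespace Summit.CriticalPhenomena.PercolationContinuityZ3.Theorems.TwoArmsRatioExponent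

open MeasureTheory Filter Topology
open Literature.Probability.LatticeModels Literature.Probability.Percolation
open Summit.CriticalPhenomena.PercolationContinuityZ3.Theses
open Summit.CriticalPhenomena.PercolationContinuityZ3.Theorems.NearLinearTwoClusterDecay.Negative
open Summit.CriticalPhenomena.PercolationContinuityZ3.Theorems.TwoArmsRatioExponent

noncomputable section

/-- The crux's set-builder event is `twoClusterEvt r n` (reorder two existentials). [folklore] -/
theorem setOf_twoArms_eq_twoClusterEvt (r n : ℕ) :
    {ω : BondConfig (Site 3) | ∃ u ∈ box 3 r, ∃ v ∈ box 3 r,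
        (∃ y ∈ innerBoundary (zdGraph 3) (box 3 n), ω ∈ openConnIn ↑(box 3 n) u y) ∧
        (∃ y ∈ innerBoundary (zdGraph 3) (box 3 n), ω ∈ openConnIn ↑(box 3 n) v y) ∧
        ω ∉ openConnIn ↑(box 3 n) u v} = twoClusterEvt r n := by
  ext ω
  constructor
  · rintro ⟨u, hu, v, hv, ⟨y, hy, h1⟩, ⟨y', hy', h2⟩, h3⟩
    exact ⟨u, hu, v, hv, y, hy, y', hy', h1, h2, h3⟩
  · rintro ⟨u, hu, v, hv, y, hy, y', hy', h1, h2, h3⟩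
    exact ⟨u, hu, v, hv, ⟨y, hy, h1⟩, ⟨y', hy', h2⟩, h3⟩

/-- **The crux in sibling vocabulary**: `TwoArmsRatioExponent ↔ ∃ c > 1, C, ∀ 1 ≤ r ≤ n,
P_{p_c}(twoClusterEvt r n) ≤ C (r/n)^c`. [folklore] -/
theorem twoArmsRatioExponent_iff :
    PercRayRenewal.TwoArmsRatioExponent ↔
      ∃ c C : ℝ, 1 < c ∧ ∀ r n : ℕ, 1 ≤ r → r ≤ n →
        critBond.real (twoClusterEvt r n) ≤ C * ((r : ℝ) / n) ^ c := by
  unfold PercRayRenewal.TwoArmsRatioExponent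
  simp only [setOf_twoArms_eq_twoClusterEvt]

/-- **`T2 ⇒` the pointwise unit-box two-arms law** `P(twoClusterEvt 1 n) ≤ C n^{-c}`, `c > 1`
(the instance `r = 1`). [folklore] -/
theorem unitBox_law_of_twoArmsRatioExponent (h : PercRayRenewal.TwoArmsRatioExponent) :
    ∃ c C : ℝ, 1 < c ∧ ∀ n : ℕ, 1 ≤ n →
      critBond.real (twoClusterEvt 1 n) ≤ C * (n : ℝ) ^ (-c) := by
  obtain ⟨c, C, hc, hP⟩ := twoArmsRatioExponent_iff.1 h
  refine ⟨c, C, hc, fun n hn => ?_⟩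
  have h1 := hP 1 n le_rfl hn
  have hn0 : (0 : ℝ) < n := by exact_mod_cast hn
  calc critBond.real (twoClusterEvt 1 n) ≤ C * (((1 : ℕ) : ℝ) / n) ^ c := h1
    _ = C * (n : ℝ) ^ (-c) := by
        rw [Nat.cast_one, one_div, Real.inv_rpow hn0.le, Real.rpow_neg hn0.le]

/-- **`T2 ⇒ AtExponent α` for every `α > 1`**: along `m = ⌈n^α⌉`,
`P(twoClusterEvt n m) ≤ C (n/m)^c ≤ C n^{-(α-1)c} → 0`. [folklore] -/
theorem atExponent_of_twoArmsRatioExponent (h : PercRayRenewal.TwoArmsRatioExponent) {α : ℝ}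
    (hα : 1 < α) : AtExponent α := by
  obtain ⟨c, C, hc, hP⟩ := twoArmsRatioExponent_iff.1 h
  have hc0 : 0 < c := zero_lt_one.trans hc
  -- the comparison sequence `C * n^{(1-α)c} → 0`
  have hlim : Tendsto (fun n : ℕ => C * ((n : ℝ) ^ ((1 - α) * c))) atTop (𝓝 0) := by
    have hneg : (1 - α) * c < 0 := mul_neg_of_neg_of_pos (by linarith) hc0
    have h0 : Tendsto (fun n : ℕ => (n : ℝ) ^ (-(-((1 - α) * c)))) atTop (𝓝 0) :=
      (tendsto_rpow_neg_atTop (neg_pos.2 hneg)).comp tendsto_natCast_atTop_atTop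
    simp only [neg_neg] at h0
    simpa using h0.const_mul C
  refine squeeze_zero' (Eventually.of_forall fun n => measureReal_nonneg) ?_ hlim
  filter_upwards [eventually_ge_atTop 1] with n hn
  have hn' : (1 : ℝ) ≤ n := by exact_mod_cast hn
  have hn0 : (0 : ℝ) < n := by positivity
  have hnm : n ≤ ⌈(n : ℝ) ^ α⌉₊ := le_ceil_rpow hn hα.le
  have hmain := hP n ⌈(n : ℝ) ^ α⌉₊ hn hnm
  -- `(n / ⌈n^α⌉)^c ≤ (n^{1-α})^c = n^{(1-α)c}`
  have hCnonneg : 0 ≤ C := by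
    -- from the instance r = n = 1: 0 < P ≤ C * 1
    have h11 := hP 1 1 le_rfl le_rfl
    have hpos : 0 < critBond.real (twoClusterEvt 1 1) := real_twoClusterEvt_pos le_rfl le_rfl
    have : (0 : ℝ) < C * (((1 : ℕ) : ℝ) / ((1 : ℕ) : ℝ)) ^ c := hpos.trans_le h11
    simpa using this.le
  have hratio : ((n : ℝ) / ⌈(n : ℝ) ^ α⌉₊) ≤ (n : ℝ) ^ (1 - α) := by
    have hceil : (n : ℝ) ^ α ≤ ⌈(n : ℝ) ^ α⌉₊ := Nat.le_ceil _
    have hpow : 0 < (n : ℝ) ^ α := Real.rpow_pos_of_pos hn0 α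
    calc (n : ℝ) / ⌈(n : ℝ) ^ α⌉₊ ≤ (n : ℝ) / (n : ℝ) ^ α :=
          div_le_div_of_nonneg_left hn0.le hpow hceil
      _ = (n : ℝ) ^ (1 - α) := by
          rw [Real.rpow_sub hn0, Real.rpow_one]
  have hρ0 : 0 ≤ (n : ℝ) / ⌈(n : ℝ) ^ α⌉₊ := by positivity
  calc critBond.real (twoClusterEvt n ⌈(n : ℝ) ^ α⌉₊)
      ≤ C * ((n : ℝ) / ⌈(n : ℝ) ^ α⌉₊) ^ c := hmain
    _ ≤ C * ((n : ℝ) ^ (1 - α)) ^ c :=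
        mul_le_mul_of_nonneg_left (Real.rpow_le_rpow hρ0 hratio hc0.le) hCnonneg
    _ = C * (n : ℝ) ^ ((1 - α) * c) := by rw [← Real.rpow_mul hn0.le]

/-- **DOMINANCE I: `T2 ⇒ CritBoxTwoArmsDecay` (crux stmt-CriticalPhenomena-0859, route
`PercFiniteBoxLRO`: decay at every aspect exponent `α > 1`).** [folklore] -/
theorem critBoxTwoArmsDecay_of_twoArmsRatioExponent (h : PercRayRenewal.TwoArmsRatioExponent) :
    PercFiniteBoxLRO.CritBoxTwoArmsDecay :=
  critBoxTwoArmsDecay_iff.2 fun _ hα => atExponent_of_twoArmsRatioExponent h hα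

/-- **DOMINANCE II: `T2 ⇒ NearLinearTwoClusterDecay` (crux stmt-CriticalPhenomena-5785, route
`PercShatteringRace`: the instance `α = 7/6`).** [folklore] -/
theorem nearLinearTwoClusterDecay_of_twoArmsRatioExponent
    (h : PercRayRenewal.TwoArmsRatioExponent) : PercShatteringRace.NearLinearTwoClusterDecay :=
  nearLinearTwoClusterDecay_iff.2 (atExponent_of_twoArmsRatioExponent h (by norm_num))

/-! ## The finite-size criterion with any power saving gives the sibling cruxes -/

/-- **FS_ε ⇒ `AtExponent α` for every `α > 1`.**  If at one aspect ratio `M ≥ 2` the thinned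
two-distinct-crossings probability has ANY uniform power saving, `P(outer(s, M s)) ≤ M^{-ε}` for all
`s ≥ s₀` with `ε > 0`, then `P(twoClusterEvt n ⌈n^α⌉) ≤ M^ε n^{-(α-1)ε} → 0`. [folklore] -/
theorem atExponent_of_fs_eps {M s₀ : ℕ} (hM : 2 ≤ M) (hs₀ : 1 ≤ s₀) {ε : ℝ} (hε : 0 < ε)
    (h : ∀ s : ℕ, s₀ ≤ s → critBond.real ((fun ω : BondConfig (Site 3) =>
      ω ∩ (Set.sym2 (↑(box 3 s) : Set (Site 3)))ᶜ) ⁻¹' twoClusterEvt s (M * s)) ≤ (M : ℝ) ^ (-ε))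
    {α : ℝ} (hα : 1 < α) : AtExponent α := by
  have hMpos : (0 : ℝ) < M := by exact_mod_cast (lt_of_lt_of_le (by norm_num) hM : 0 < M)
  -- comparison sequence `M^ε * n^{(1-α)ε} → 0`
  have hlim : Tendsto (fun n : ℕ => (M : ℝ) ^ ε * ((n : ℝ) ^ ((1 - α) * ε))) atTop (𝓝 0) := by
    have hneg : (1 - α) * ε < 0 := mul_neg_of_neg_of_pos (by linarith) hε
    have h0 : Tendsto (fun n : ℕ => (n : ℝ) ^ (-(-((1 - α) * ε)))) atTop (𝓝 0) :=
      (tendsto_rpow_neg_atTop (neg_pos.2 hneg)).comp tendsto_natCast_atTop_atTop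
    simp only [neg_neg] at h0
    simpa using h0.const_mul ((M : ℝ) ^ ε)
  refine squeeze_zero' (Eventually.of_forall fun n => measureReal_nonneg) ?_ hlim
  filter_upwards [eventually_ge_atTop s₀] with n hn
  have hn1 : 1 ≤ n := hs₀.trans hn
  have hn' : (1 : ℝ) ≤ n := by exact_mod_cast hn1
  have hn0 : (0 : ℝ) < n := by positivity
  have hnm : n ≤ ⌈(n : ℝ) ^ α⌉₊ := le_ceil_rpow hn1 hα.le
  have hmain := real_twoClusterEvt_le_of_fs hM hε.le h hn1 hn hnm
  have hratio : ((n : ℝ) / ⌈(n : ℝ) ^ α⌉₊) ≤ (n : ℝ) ^ (1 - α) := by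
    have hceil : (n : ℝ) ^ α ≤ ⌈(n : ℝ) ^ α⌉₊ := Nat.le_ceil _
    have hpow : 0 < (n : ℝ) ^ α := Real.rpow_pos_of_pos hn0 α
    calc (n : ℝ) / ⌈(n : ℝ) ^ α⌉₊ ≤ (n : ℝ) / (n : ℝ) ^ α :=
          div_le_div_of_nonneg_left hn0.le hpow hceil
      _ = (n : ℝ) ^ (1 - α) := by rw [Real.rpow_sub hn0, Real.rpow_one]
  have hρ0 : 0 ≤ (n : ℝ) / ⌈(n : ℝ) ^ α⌉₊ := by positivity
  calc critBond.real (twoClusterEvt n ⌈(n : ℝ) ^ α⌉₊)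
      ≤ (M : ℝ) ^ ε * ((n : ℝ) / ⌈(n : ℝ) ^ α⌉₊) ^ ε := hmain
    _ ≤ (M : ℝ) ^ ε * ((n : ℝ) ^ (1 - α)) ^ ε :=
        mul_le_mul_of_nonneg_left (Real.rpow_le_rpow hρ0 hratio hε.le) (Real.rpow_nonneg hMpos.le ε)
    _ = (M : ℝ) ^ ε * (n : ℝ) ^ ((1 - α) * ε) := by rw [← Real.rpow_mul hn0.le]

/-- **FS_ε ⇒ `CritBoxTwoArmsDecay` (stmt-CriticalPhenomena-0859).** [folklore] -/
theorem critBoxTwoArmsDecay_of_fs_eps {M s₀ : ℕ} (hM : 2 ≤ M) (hs₀ : 1 ≤ s₀) {ε : ℝ} (hε : 0 < ε)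
    (h : ∀ s : ℕ, s₀ ≤ s → critBond.real ((fun ω : BondConfig (Site 3) =>
      ω ∩ (Set.sym2 (↑(box 3 s) : Set (Site 3)))ᶜ) ⁻¹' twoClusterEvt s (M * s)) ≤ (M : ℝ) ^ (-ε)) :
    PercFiniteBoxLRO.CritBoxTwoArmsDecay :=
  critBoxTwoArmsDecay_iff.2 fun _ hα => atExponent_of_fs_eps hM hs₀ hε h hα

/-- **FS_ε ⇒ `NearLinearTwoClusterDecay` (stmt-CriticalPhenomena-5785).** [folklore] -/
theorem nearLinearTwoClusterDecay_of_fs_eps {M s₀ : ℕ} (hM : 2 ≤ M) (hs₀ : 1 ≤ s₀) {ε : ℝ}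
    (hε : 0 < ε)
    (h : ∀ s : ℕ, s₀ ≤ s → critBond.real ((fun ω : BondConfig (Site 3) =>
      ω ∩ (Set.sym2 (↑(box 3 s) : Set (Site 3)))ᶜ) ⁻¹' twoClusterEvt s (M * s)) ≤ (M : ℝ) ^ (-ε)) :
    PercShatteringRace.NearLinearTwoClusterDecay :=
  nearLinearTwoClusterDecay_iff.2 (atExponent_of_fs_eps hM hs₀ hε h (by norm_num))

/-! ## FS sits between the thinned ratio law and the crux: `T2' ⇒ FS ⇒ T2` -/

/-- **The thinned ratio law implies FS** (so, with `ratioLaw_of_finiteSizeCriterion`,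
`T2' ⇒ FS ⇒ T2`, where `T2'` is the crux with `A₂(r,n)` replaced by the larger thinned event
`outer(r,n) ⊇ A₂(r,n)`): from `P(outer(r,n)) ≤ C (r/n)^c`, `c > 1`, take `c' = (1+c)/2` and an
integer `M ≥ 2` with `C ≤ M^{c-c'}`; then `P(outer(s, Ms)) ≤ C M^{-c} ≤ M^{-c'}` for all `s ≥ 1`.
[folklore] -/
theorem fs_of_outerRatioLaw
    (h : ∃ c C : ℝ, 1 < c ∧ ∀ r n : ℕ, 1 ≤ r → r ≤ n →
      critBond.real ((fun ω : BondConfig (Site 3) => ω ∩ (Set.sym2 (↑(box 3 r) : Set (Site 3)))ᶜ) ⁻¹'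
        twoClusterEvt r n) ≤ C * ((r : ℝ) / n) ^ c) :
    ∃ M s₀ : ℕ, 2 ≤ M ∧ 1 ≤ s₀ ∧ ∃ c : ℝ, 1 < c ∧ ∀ s : ℕ, s₀ ≤ s →
      critBond.real ((fun ω : BondConfig (Site 3) => ω ∩ (Set.sym2 (↑(box 3 s) : Set (Site 3)))ᶜ) ⁻¹'
        twoClusterEvt s (M * s)) ≤ (M : ℝ) ^ (-c) := by
  obtain ⟨c, C, hc, hP⟩ := h
  -- c' = (1 + c)/2, δ = c - c' > 0; M = an integer ≥ 2 with C ≤ M^δ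
  set c' : ℝ := (1 + c) / 2 with hc'
  have hc'1 : 1 < c' := by rw [hc']; linarith
  have hδ : 0 < c - c' := by rw [hc']; linarith
  -- choose M : ℕ with max 2 (C^{1/δ}) ≤ M
  obtain ⟨M, hMge⟩ := exists_nat_ge (max 2 ((max C 1) ^ (1 / (c - c'))))
  have hM2R : (2 : ℝ) ≤ M := le_trans (le_max_left _ _) hMge
  have hM2 : 2 ≤ M := by exact_mod_cast hM2R
  have hMpos : (0 : ℝ) < M := by linarith
  have hCM : max C 1 ≤ (M : ℝ) ^ (c - c') := by
    have h1 : (max C 1) ^ (1 / (c - c')) ≤ (M : ℝ) := le_trans (le_max_right _ _) hMge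
    have h0 : 0 ≤ max C 1 := le_trans zero_le_one (le_max_right _ _)
    calc max C 1 = ((max C 1) ^ (1 / (c - c'))) ^ (c - c') := by
          rw [← Real.rpow_mul h0, one_div, inv_mul_cancel₀ hδ.ne', Real.rpow_one]
      _ ≤ (M : ℝ) ^ (c - c') :=
          Real.rpow_le_rpow (Real.rpow_nonneg h0 _) h1 hδ.le
  refine ⟨M, 1, hM2, le_rfl, c', hc'1, fun s hs => ?_⟩
  have hsMs : s ≤ M * s := Nat.le_mul_of_pos_left s (by omega)
  have hmain := hP s (M * s) hs hsMs
  have hs0 : (0 : ℝ) < s := by exact_mod_cast hs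
  have hratio : ((s : ℝ) / ((M * s : ℕ) : ℝ)) = (M : ℝ)⁻¹ := by
    rw [Nat.cast_mul]; field_simp
  rw [hratio, Real.inv_rpow hMpos.le] at hmain
  -- C * (M^c)⁻¹ ≤ M^{-c'}  since  C ≤ M^{c-c'}
  have hC1 : C ≤ (M : ℝ) ^ (c - c') := le_trans (le_max_left _ _) hCM
  calc critBond.real ((fun ω : BondConfig (Site 3) =>
          ω ∩ (Set.sym2 (↑(box 3 s) : Set (Site 3)))ᶜ) ⁻¹' twoClusterEvt s (M * s))
      ≤ C * ((M : ℝ) ^ c)⁻¹ := hmain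
    _ ≤ (M : ℝ) ^ (c - c') * ((M : ℝ) ^ c)⁻¹ :=
        mul_le_mul_of_nonneg_right hC1 (inv_nonneg.2 (Real.rpow_nonneg hMpos.le c))
    _ = (M : ℝ) ^ (-c') := by
        rw [← Real.rpow_neg hMpos.le, ← Real.rpow_add hMpos]
        congr 1; ring

/-! ## The route needs T2 only in the jump world -/

/-- **The route over-demands: only the JUMP-WORLD form of T2 is needed.**  Since
`JumpLineAvoidanceDecay` is itself conditional on `0 < θ(p_c)` and the (proved) `Assembly` is
`T2 → G → θ(p_c) = 0`, the sub-problem already follows from `(0 < θ(p_c) → T2)`, `G` and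
`Assembly`: if `θ(p_c) ≠ 0` then `θ(p_c) > 0` (`θ ≥ 0`), so `T2` holds, and `Assembly` gives
`θ(p_c) = 0` — contradiction.  Hence the crux may be RESTATED by the planners as
`0 < theta (zdGraph 3) 0 (criticalProbI 3) → TwoArmsRatioExponent` (vacuous when `θ(p_c) = 0`, in
particular immune to the `d > 6` objection), and likewise FS may be assumed only in the jump world.
[folklore] -/
theorem percolationContinuityZ3_of_jumpWorldT2
    (hT2j : 0 < theta (zdGraph 3) (0 : Site 3) (criticalProbI 3) → PercRayRenewal.TwoArmsRatioExponent)
    (hG : PercRayRenewal.JumpLineAvoidanceDecay) (hA : PercRayRenewal.Assembly) :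
    _root_.PercolationContinuityZ3 := by
  by_contra h
  have hne : theta (zdGraph 3) (0 : Site 3) (criticalProbI 3) ≠ 0 := fun h0 =>
    h (Literature.Probability.Percolation.percolationContinuityZ3_iff.2 h0)
  have hθ : 0 < theta (zdGraph 3) (0 : Site 3) (criticalProbI 3) :=
    lt_of_le_of_ne (by unfold theta; exact measureReal_nonneg) (Ne.symm hne)
  exact h (hA (hT2j hθ) hG)

/-- **Jump-world FS suffices for the sub-problem** (with `G` and the proved `Assembly`). [folklore] -/
theorem percolationContinuityZ3_of_jumpWorldFS
    (hFSj : 0 < theta (zdGraph 3) (0 : Site 3) (criticalProbI 3) →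
      ∃ M s₀ : ℕ, 2 ≤ M ∧ 1 ≤ s₀ ∧ ∃ c : ℝ, 1 < c ∧ ∀ s : ℕ, s₀ ≤ s →
        critBond.real ((fun ω : BondConfig (Site 3) => ω ∩ (Set.sym2 (↑(box 3 s) : Set (Site 3)))ᶜ) ⁻¹'
          twoClusterEvt s (M * s)) ≤ (M : ℝ) ^ (-c))
    (hG : PercRayRenewal.JumpLineAvoidanceDecay) (hA : PercRayRenewal.Assembly) :
    _root_.PercolationContinuityZ3 := by
  refine percolationContinuityZ3_of_jumpWorldT2 (fun hθ => ?_) hG hA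
  obtain ⟨c, C, hc, h⟩ := ratioLaw_of_finiteSizeCriterion (hFSj hθ)
  unfold PercRayRenewal.TwoArmsRatioExponent
  refine ⟨c, C, hc, fun r n hr hrn => ?_⟩
  rw [setOf_twoArms_eq_twoClusterEvt]
  exact h r n hr hrn

/-! ## Uniform non-certainty of the thinned event at ONE aspect ratio already gives the siblings -/

/-- **Any uniform bound `< 1` at one aspect ratio closes stmt-0859 and stmt-5785.**  If for some
`M ≥ 2`, `s₀` and `η ∈ (0, 1)` the thinned two-distinct-crossings probability satisfies
`P(outer(s, M s)) ≤ 1 - η` for all `s ≥ s₀`, then `AtExponent α` for every `α > 1` (take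
`ε = -log(1-η)/log M > 0`, so that `M^{-ε} = 1 - η`, in `atExponent_of_fs_eps`): sub-multiplicativity
turns mere uniform non-certainty into a polynomial rate. [folklore] -/
theorem atExponent_of_outer_le_one_sub {M s₀ : ℕ} (hM : 2 ≤ M) (hs₀ : 1 ≤ s₀) {η : ℝ} (hη : 0 < η)
    (hη1 : η < 1)
    (h : ∀ s : ℕ, s₀ ≤ s → critBond.real ((fun ω : BondConfig (Site 3) =>
      ω ∩ (Set.sym2 (↑(box 3 s) : Set (Site 3)))ᶜ) ⁻¹' twoClusterEvt s (M * s)) ≤ 1 - η)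
    {α : ℝ} (hα : 1 < α) : AtExponent α := by
  have hMpos : (0 : ℝ) < M := by exact_mod_cast (lt_of_lt_of_le (by norm_num) hM : 0 < M)
  have hM1 : (1 : ℝ) < M := by exact_mod_cast (lt_of_lt_of_le (by norm_num) hM : 1 < M)
  have hlogM : 0 < Real.log M := Real.log_pos hM1
  have h1η : 0 < 1 - η := by linarith
  have hlogη : Real.log (1 - η) < 0 := Real.log_neg h1η (by linarith)
  set ε : ℝ := -Real.log (1 - η) / Real.log M with hε
  have hεpos : 0 < ε := by
    rw [hε]; exact div_pos (neg_pos.2 hlogη) hlogM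
  have hMε : (M : ℝ) ^ (-ε) = 1 - η := by
    rw [Real.rpow_def_of_pos hMpos, hε]
    have : Real.log M * -(-Real.log (1 - η) / Real.log M) = Real.log (1 - η) := by
      field_simp
    rw [this, Real.exp_log h1η]
  refine atExponent_of_fs_eps hM hs₀ hεpos (fun s hs => ?_) hα
  rw [hMε]; exact h s hs

/-- **Corollary for stmt-0859** (`CritBoxTwoArmsDecay`) from uniform non-certainty at one aspect
ratio. [folklore] -/
theorem critBoxTwoArmsDecay_of_outer_le_one_sub {M s₀ : ℕ} (hM : 2 ≤ M) (hs₀ : 1 ≤ s₀) {η : ℝ}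
    (hη : 0 < η) (hη1 : η < 1)
    (h : ∀ s : ℕ, s₀ ≤ s → critBond.real ((fun ω : BondConfig (Site 3) =>
      ω ∩ (Set.sym2 (↑(box 3 s) : Set (Site 3)))ᶜ) ⁻¹' twoClusterEvt s (M * s)) ≤ 1 - η) :
    PercFiniteBoxLRO.CritBoxTwoArmsDecay :=
  critBoxTwoArmsDecay_iff.2 fun _ hα => atExponent_of_outer_le_one_sub hM hs₀ hη hη1 h hα

/-- **Corollary for stmt-5785** (`NearLinearTwoClusterDecay`) from uniform non-certainty at one
aspect ratio. [folklore] -/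
theorem nearLinearTwoClusterDecay_of_outer_le_one_sub {M s₀ : ℕ} (hM : 2 ≤ M) (hs₀ : 1 ≤ s₀)
    {η : ℝ} (hη : 0 < η) (hη1 : η < 1)
    (h : ∀ s : ℕ, s₀ ≤ s → critBond.real ((fun ω : BondConfig (Site 3) =>
      ω ∩ (Set.sym2 (↑(box 3 s) : Set (Site 3)))ᶜ) ⁻¹' twoClusterEvt s (M * s)) ≤ 1 - η) :
    PercShatteringRace.NearLinearTwoClusterDecay :=
  nearLinearTwoClusterDecay_iff.2 (atExponent_of_outer_le_one_sub hM hs₀ hη hη1 h (by norm_num))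

end

end Summit.CriticalPhenomena.PercolationContinuityZ3.Theorems.TwoArmsRatioExponent
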